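import Summits.HodgeConjecture.HodgeConjecture.Theorems.F0P6aEReadings
import Literature.FieldTheory.AlgClosed.AdicCompletionAlgClosureEquivComplex
import Literature.AlgebraicGeometry.Motives.GaloisThickeningLiftAlongFieldHom
import Literature.AlgebraicGeometry.AbelianSchemes.SerreCoverAlongPointBaseChange
import HarnessLib
import HarnessLib.Audit.LibrarySuggestionsDenyListCruxes

/-!
# `F0P6aCoverEOfComplex` — ★ VERBATIM TWIN (K6 P∕E column wave E2, LEAD F0P6-plan «M-142a» (B); RE-HOME TABLE v1.7 (LA7-plan (g7)), canonical header «M-142a» (A), carrier «M-142d» «P-κ») of the (W-L) organ module `Lines/F0_P6a_CoverEOfComplex.lean`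

**SIZE-LINT SPLIT ×2** (`Theorems/` files with proofs are ≤ 400 lines): parts `Theorems/F0P6aCoverEOfComplexBody.lean` → `Theorems/F0P6aCoverEOfComplex.lean`, each importing the previous, cut at declaration boundaries of `Lines/F0_P6a_CoverEOfComplex.lean`; namespaces AND sections KEPT and re-opened per part (with their `open`∕`variable` lines replayed verbatim); the options preamble is repeated. This is PART 1.

This `Theorems/` module is the TREE BYTES of `Summits/HodgeConjecture/HodgeConjecture/Cruxes/HLiu418/Lines/F0_P6a_CoverEOfComplex.lean` (tree sha16 ec52ca66282759d5, 448 l.; sorry-free, stub-free = class B of RE-HOME TABLE v1.7)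
re-homed VERBATIM with the NAMESPACE KEPT (`Summit.HodgeConjecture.HodgeConjecture.Cruxes.HLiu418.F0P6aCoverEOfComplex`), so every fully-qualified name of its 20 declarations is UNCHANGED
(0 FQN moves, 0 downstream bytes, 0 statement bytes).  The only edits are (a) this re-headed module docstring, (b) the `Lines` imports switched to their ★ homes (l.1 `Lines.F0_P6a_EReadings` → `Theorems.F0P6aEReadings`),
and (c) on the docstrings of the header-CLOSED `def … : Prop` letters (`coverKerBody`, `coverBody`) the locator tokens are spelled `(print: …)` instead of `[cite: …]` — same locators, same prose — because a `[cite:]`-tagged closed Prop in a `Theorems/` proposal is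
RELOCATED to `Literature/` by the gate («STATE IT INLINE» rule; observed p852785∕p852786, LA-ref1 (g5) BOX K5 #R1), which would MOVE the FQN; these Props are statement
ABBREVIATIONS of our own sockets, not printed facts (precedent ★ `Theorems/F0P6aModuliDatumDefs.lean` `RecordModuliDatumCofinal` `(print:)` ×5).

Why: E-column parents-first — this module imports only `Lines/F0_P6a_EReadings` (★ twin = wave E1) and is imported by `F0_P6a_StubESHEET` and, through it, by
`F0_P6a_EExports` → `F0_P6a_StubGEN` → … → MAIN; a `Theorems/` file cannot import a `Lines/` workfile (gate import fence), so it is re-homed before them.  After its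
LAST part is ★ the `Lines` original becomes the next edition = SHIM (`import` of this module + `HarnessLib` + carrier; 0 declarations) in a K6 shim wave on the LEAD՚s cue.
HC_CM is proved only modulo the 7 printed citations (2 remaining: hLiu418 = stmt-HodgeConjecture-24832, h413 = stmt-HodgeConjecture-24833) until rung 0 closes; a re-home is count-neutral.

## Import provenance (header is CANONICAL: bare `import` lines, «M-142a» (A); the ROOT part carries `HarnessLib.Audit.LibrarySuggestionsDenyListCruxes`, «M-142d» «P-κ»)
- `Summits.HodgeConjecture.HodgeConjecture.Theorems.F0P6aEReadings` — ★ K6 E1 twin of `Lines/F0_P6a_EReadings.lean` ED. 2 18b1390e9a57b55f (LAST part; `…EReadingsDefs` → `…EReadingsHecke` ride the import)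
- `Literature.FieldTheory.AlgClosed.AdicCompletionAlgClosureEquivComplex` — ★ p849445 + ED. 2 p850285 (LA4-p01): `σ : F̄_w ≃ₐ[F] ℂ` over `ι₁`, and RELATIVE TO A SHEET (`σ ∘ e′ = τE`)
- `Literature.AlgebraicGeometry.Motives.GaloisThickeningLiftAlongFieldHom` — ★ p849545 + ED. 2 p850145 (LA4-p01): sheet points along a field hom ∕ backwards along an iso
- `Literature.AlgebraicGeometry.AbelianSchemes.SerreCoverAlongPointBaseChange` — ★ p850295 (LA4-p01 (g3)): `coverKer∕cover_readAt_comp_of_eq` (+ LA4-p03՚s ★ p849565 `coverKer_readAt_comp`)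
- `HarnessLib`

## Original module docstring (verbatim)
# LEAF `Lines/F0_P6a_CoverEOfComplex.lean` ED. 1 — pen LA4-plan (g2) publish of LA4-p01 (g3)՚s `CoverEOfComplex.v2` 326681b5c15ffccd BYTE-IDENTICAL except: namespace `…F0P6aEReadings` → `…F0P6aCoverEOfComplex` (leaf = namespace convention) + `open …F0P6aEReadings`; consumers `open Summit.HodgeConjecture.HodgeConjecture.Cruxes.HLiu418.F0P6aCoverEOfComplex`.
# «(S5) THE `ℂ ↔ F̄_w` SEAM FOR THE SERRE COVERS» — `CoverKerE` ∕ `CoverE` AT THE `F̄_w`-SHEET POINTS FROM THE SAME ROWS AT COMPLEX POINTS (HOME bytes,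
# Lines vocabulary; «L4» LA4-p01 (g3), DEAL #31 (S5) for LA7-p01 (g3)՚s `stub_SHEET` closer LEG-D∕LEG-E; by import on TREE E-READINGS ED. 3; NOT a proposal —
# every transport step is a ★ one-liner: p850295 `coverKer∕cover_readAt_comp_of_eq`, p849545∕p850145 sheet points, p849445∕p850285 `σ`)

* §0 the bodies of `CoverKerE` ∕ `CoverE` in ★ BODY CURRENCY at two abstract points `ℓ, ℓ′ : Spec Ω → X` of ONE tuple `(univ, act, dual, pol, lvl)` over
  `X = (S.M Kc) ⊗_F Fᵢ` (fibres `univ.baseChange ℓ`, `ι(a)_ℓ = baseChangeHom (act.i a) ℓ`, `dual.baseChange ℓ`, `(pol.baseChange ℓ).lam`, level points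
  `univ.restrictPt ℓ (lvl.section_ a)`): `coverKerBody Ω … 𝔞 n ℓ ℓ′` ((t1)(t1′)(t2)(t3)(t4)(t5)) and `coverBody Ω … 𝔞 n ℓ ℓ′` ((t1)–(t5)); the JUNCTIONS
  `coverKerE_iff_coverKerBody : CoverKerE S Kc w e 𝒜 ρ D pol lvl e′ 𝔞 n y ↔ coverKerBody F̄_w 𝒜 ρ D pol lvl 𝔞 n (ℓ_e y).left (ℓ_{e′} y).left` and
  `coverE_iff_coverBody` are `Iff.rfl` (readers `schEOf`∕`actEOf`∕`dualEOf`∕`polEOf`∕`lvlPtEOf` unfold on the nose; like the letter, `MonObj` is opened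
  only on the kernel-clause declarations);
* §1 THE CORE (★ p850295, any `x : Spec Ω → Spec Ω′`, NO isomorphism hypothesis — covers have no kernel-on-points ∕ surjectivity clause):
  `coverKerBody_of_eq`∕`coverBody_of_eq` («read at `(ℓ, ℓ′)` over `Ω′`, get the reading at `(m, m′)` over `Ω` whenever `x ≫ ℓ = m`, `x ≫ ℓ′ = m′`»);
* §2 THE HEADS IN E-CURRENCY:
  - `coverKerE_of_readAt` ∕ `coverE_of_readAt` — from the body at ANY pair `(m, m′)` over any `Ω′` with `x ≫ m = (ℓ_e y).left`, `x ≫ m′ = (ℓ_{e′} y).left`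
    (USE: `Ω′ := ℂ`, `x := Spec σ⁻¹`, `m := Spec σ ≫ (ℓ_e y).left` — the complex point of the sheet point — and `hm := Spec σ⁻¹ ≫ Spec σ = 𝟙`);
  - `coverKerE_of_algEquiv` ∕ `coverE_of_algEquiv` — from the body at the pushed sheet points `(ℓ_{σ∘e} y′, ℓ_{σ∘e′} y′)` over `Ω′` for `σ : F̄_w ≃ₐ[F] Ω′` and
    any `y′` with `y′.left = Spec σ ≫ y.left` (★ `thickeningLift_left_eq_specMap_symm_comp_of_left_eq`);
  - `coverKerE_of_complex` ∕ `coverE_of_complex` — `Ω′ := ℂ` through `ι₁`: if for EVERY complex sheet `eℂ` and every complex point `z` the body holds at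
    `(ℓ_{eℂ} z, ℓ_{eℂ∘γ} z)`, then `CoverKerE … e′ … (e′ ∘ γ) 𝔞 n y` for every `F̄_w`-sheet `e′` and point `y` (`σ` from ★ p849445; `(σ∘e′)∘γ = σ∘(e′∘γ)`);
  - `coverKerE_of_complex_sheet` ∕ `coverE_of_complex_sheet` — the same from the CHART SHEET ONLY: if the body holds at `(ℓ_{τ} z, ℓ_{τ∘γ} z)` for ONE complex
    sheet `τ : Fᵢ →ₐ[F] ℂ` (all `z`), then it holds at every `F̄_w`-sheet `e′` — `σ` RELATIVE TO THE SHEET (★ ED. 2 p850285 `exists_algEquiv_…_apply_eq`: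
    `σ ∘ e′ = τ`), for `Fᵢ` a number field;
  - the forward direction `coverKerBody_comp_of_coverKerE` (the `F̄_w` rows pushed to `(x ≫ ℓ_e y, x ≫ ℓ_{e′} y)` for any `x`, e.g. `x := Spec σ`).
USE (LEG-E of `stub_SHEET`, LA7-p01 (g3)): produce the complex rows in `coverKerBody ℂ …`∕`coverBody ℂ …` form at the complex sheet points and finish with
`coverKerE_of_complex_sheet` (chart sheet `τE` as an `F`-algebra hom, `hD := P.hatNormalised`) or `coverKerE_of_complex`; or, with the rows at hand at an explicit
pair `(m, m′)` over ℂ, `coverKerE_of_readAt`.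
HC_CM is proved only modulo the 7 printed citations (2 remaining: hLiu418 = stmt-HodgeConjecture-24832, h413 = stmt-HodgeConjecture-24833) until rung 0 closes.
-/

set_option autoImplicit false

noncomputable section

-- Mathlib's `Over`∕pull-back API is stated across semireducible wrappers (as in the ★ `AbelianSchemes/*` files).
set_option backward.isDefEq.respectTransparency false


namespace Summit.HodgeConjecture.HodgeConjecture.Cruxes.HLiu418.F0P6aCoverEOfComplex

open Summit.HodgeConjecture.HodgeConjecture.Cruxes.HLiu418.F0P6aEReadings

set_option linter.dupNamespace false

open CategoryTheory CategoryTheory.Limits NumberField IsDedekindDomain MulAction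
open scoped Matrix Pointwise
open Literature.NumberTheory.GaloisRepresentations
open Literature.NumberTheory.Automorphic Literature.NumberTheory.Automorphic.UnitaryGroup
open Literature.AlgebraicGeometry.ShimuraVarieties.UnitaryCanonicalModel
open Literature.NumberTheory.Automorphic.Liu2021.AppendixC
open Literature.AlgebraicGeometry.Motives (AlgPoints SchemeOver thickening thickeningLift specOver)
open Literature.AlgebraicGeometry.AbelianSchemes (AbelianSchemeOver)
open Literature.AlgebraicGeometry.AbelianSchemes.AbelianSchemeOver (baseChangeHom DualPair RingAction)

/-! ### §0 The bodies of `CoverKerE` ∕ `CoverE` in ★ currency, and the junctions -/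

section Body

variable {F : Type} [Field F] [NumberField F] [IsCMField F] {Y : AlgebraicGeometry.Scheme.{0}} (Ω : Type) [Field Ω]
  (univ : AbelianSchemeOver Y) (act : RingAction (𝓞 F) univ) (dual : univ.DualPair) (pol : univ.Polarization dual)
  {g N : ℕ} (lvl : univ.LevelStructure g N) (𝔞 : Ideal (𝓞 F)) (n : ℕ) (ℓ ℓ' : AlgebraicGeometry.Spec (.of Ω) ⟶ Y)

set_option maxHeartbeats 400000 in
open scoped MonObj Obj in
/-- **The body of `CoverKerE`** for the fibres of ONE tuple at two abstract points `ℓ, ℓ′ : Spec Ω → Y` ((t1) Serre presentation of `𝔞`, (t1′) kernel clause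
on all `T`-points, (t2) upper bound through `c•𝔞` and `n`, (t3) `c ≫ λ_{ℓ′} ≫ c^∨ = λ_ℓ ≫ [n]`, (t4) `𝒪_F`-equivariance, (t5) level points) — ★ body currency of
★ `coverKer_readAt_comp`; `= CoverKerE … y` when `ℓ = (ℓ_e y).left`, `ℓ′ = (ℓ_{e′} y).left` (readers unfolded, `coverKerE_iff_coverKerBody`).
(print: Shimura1998, §13.1 Theorem 1 (pp. 97–99); §18.6 (pp. 124–127)) (print: MumfordAV1970, §7 Thm. 4 (p. 72)) -/
def coverKerBody : Prop :=
  ∃ (c : (univ.baseChange ℓ).X ⟶ (univ.baseChange ℓ').X) (_ : IsMonHom c),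
    (∀ a ∈ 𝔞, ∃ d : (univ.baseChange ℓ').X ⟶ (univ.baseChange ℓ).X,
        c ≫ d = baseChangeHom (act.i a) ℓ ∧ d ≫ c = baseChangeHom (act.i a) ℓ') ∧
    (∀ ⦃T : SchemeOver Ω⦄ (t : T ⟶ (univ.baseChange ℓ).X), t ≫ c = 1 ↔ ∀ a ∈ 𝔞, t ≫ baseChangeHom (act.i a) ℓ = 1) ∧
    (∀ b ∈ (IsCMField.complexConj F) • 𝔞, ∃ f : (univ.baseChange ℓ).X ⟶ (univ.baseChange ℓ').X,
        c ≫ baseChangeHom (act.i b) ℓ' = f ≫ baseChangeHom (act.i (n : 𝓞 F)) ℓ') ∧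
    c ≫ (pol.baseChange ℓ').lam ≫ DualPair.dualIsogenyOver c (dual.baseChange ℓ) (dual.baseChange ℓ') =
      (pol.baseChange ℓ).lam ≫ (dual.baseChange ℓ).hat.mulN n ∧
    (∀ a : 𝓞 F, baseChangeHom (act.i a) ℓ ≫ c = c ≫ baseChangeHom (act.i a) ℓ') ∧
    (∀ a : Fin g ⊕ Fin g → ZMod N,
        (AlgPoints.map c (univ.restrictPt ℓ (lvl.section_ a)) : (univ.baseChange ℓ').toAffine.toAbelianVariety.Points Ω) =
          univ.restrictPt ℓ' (lvl.section_ a))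

set_option maxHeartbeats 400000 in
/-- **The body of `CoverE`** ((t1)–(t5), no kernel clause) at two abstract points — ★ body currency of ★ `cover_readAt_comp`; `= CoverE … y` at the sheet points
(`coverE_iff_coverBody`). (print: Shimura1998, §13.1 Theorem 1 (pp. 97–99); §18.6 (pp. 124–127)) (print: Conrad2004GrossZagier, §7, Thm. 7.6) -/
def coverBody : Prop :=
  ∃ (c : (univ.baseChange ℓ).X ⟶ (univ.baseChange ℓ').X) (_ : IsMonHom c),
    (∀ a ∈ 𝔞, ∃ d : (univ.baseChange ℓ').X ⟶ (univ.baseChange ℓ).X,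
        c ≫ d = baseChangeHom (act.i a) ℓ ∧ d ≫ c = baseChangeHom (act.i a) ℓ') ∧
    (∀ b ∈ (IsCMField.complexConj F) • 𝔞, ∃ f : (univ.baseChange ℓ).X ⟶ (univ.baseChange ℓ').X,
        c ≫ baseChangeHom (act.i b) ℓ' = f ≫ baseChangeHom (act.i (n : 𝓞 F)) ℓ') ∧
    c ≫ (pol.baseChange ℓ').lam ≫ DualPair.dualIsogenyOver c (dual.baseChange ℓ) (dual.baseChange ℓ') =
      (pol.baseChange ℓ).lam ≫ (dual.baseChange ℓ).hat.mulN n ∧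
    (∀ a : 𝓞 F, baseChangeHom (act.i a) ℓ ≫ c = c ≫ baseChangeHom (act.i a) ℓ') ∧
    (∀ a : Fin g ⊕ Fin g → ZMod N,
        (AlgPoints.map c (univ.restrictPt ℓ (lvl.section_ a)) : (univ.baseChange ℓ').toAffine.toAbelianVariety.Points Ω) =
          univ.restrictPt ℓ' (lvl.section_ a))

/-- `coverKerBody → coverBody` (drop the kernel clause). [cite: Shimura1998, §13.1 Theorem 1 (pp. 97–99)] -/
theorem coverBody_of_coverKerBody (h : coverKerBody Ω univ act dual pol lvl 𝔞 n ℓ ℓ') : coverBody Ω univ act dual pol lvl 𝔞 n ℓ ℓ' := by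
  obtain ⟨c, hc, t1, -, t2, t3, t4, t5⟩ := h
  exact ⟨c, hc, t1, t2, t3, t4, t5⟩

end Body

section Junction

variable {F : Type} [Field F] [NumberField F] [IsCMField F] {ι₁ : F →+* ℂ} {Jstar : Matrix (Fin 2) (Fin 2) F}
  {K₀ : C5.OpenCompactSubgroup ↥(finAdelic ↥(maximalRealSubfield F) F (IsCMField.complexConj F) 2 Jstar)}
  (S : RecordSystemGS F Jstar ι₁ K₀) {Fi : Type} [Field Fi] [Algebra F Fi] (Kc : C5.SmallLevel K₀) (w : HeightOneSpectrum (𝓞 F))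
  (e : Fi →ₐ[F] AlgebraicClosure (w.adicCompletion F))
  (𝒜 : AbelianSchemeOver ((Literature.AlgebraicGeometry.Motives.baseChange F Fi).obj (S.M.obj Kc)).left)
  (ρ : RingAction (𝓞 F) 𝒜) (D : 𝒜.DualPair) (pol : 𝒜.Polarization D) {g N : ℕ} (lvl : 𝒜.LevelStructure g N)
  (e' : Fi →ₐ[F] AlgebraicClosure (w.adicCompletion F)) (𝔞 : Ideal (𝓞 F)) (n : ℕ)
  (y : AlgPoints (S.M.obj Kc) (AlgebraicClosure (w.adicCompletion F)))

set_option maxHeartbeats 400000 in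
/-- **JUNCTION (kernel-clause form)**: `CoverKerE … y` IS `coverKerBody F̄_w … (ℓ_e y).left (ℓ_{e′} y).left` — the readers `schEOf`∕`actEOf`∕`dualEOf`∕`polEOf`∕`lvlPtEOf`
unfold on the nose (`(fibreHom (ρ.i a) ℓ).hom.hom.hom = baseChangeHom (ρ.i a) ℓ` by `rfl`). [cite: Shimura1998, §13.1 Theorem 1 (pp. 97–99); §18.6 (pp. 124–127)] -/
theorem coverKerE_iff_coverKerBody :
    CoverKerE S Kc w e 𝒜 ρ D pol lvl e' 𝔞 n y ↔
      coverKerBody (AlgebraicClosure (w.adicCompletion F)) 𝒜 ρ D pol lvl 𝔞 n (thickeningLift e (S.M.obj Kc) y).left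
        (thickeningLift e' (S.M.obj Kc) y).left :=
  Iff.rfl

set_option maxHeartbeats 400000 in
/-- **JUNCTION (no kernel clause)**: `CoverE … y` IS `coverBody F̄_w … (ℓ_e y).left (ℓ_{e′} y).left`. [cite: Shimura1998, §13.1 Theorem 1 (pp. 97–99); §18.6 (pp. 124–127)] -/
theorem coverE_iff_coverBody :
    CoverE S Kc w e 𝒜 ρ D pol lvl e' 𝔞 n y ↔
      coverBody (AlgebraicClosure (w.adicCompletion F)) 𝒜 ρ D pol lvl 𝔞 n (thickeningLift e (S.M.obj Kc) y).left
        (thickeningLift e' (S.M.obj Kc) y).left :=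
  Iff.rfl

/-- `CoverKerE → CoverE` on the E-side (drop (t1′)). [cite: Shimura1998, §13.1 Theorem 1 (pp. 97–99)] -/
theorem coverE_of_coverKerE (h : CoverKerE S Kc w e 𝒜 ρ D pol lvl e' 𝔞 n y) : CoverE S Kc w e 𝒜 ρ D pol lvl e' 𝔞 n y :=
  (coverE_iff_coverBody S Kc w e 𝒜 ρ D pol lvl e' 𝔞 n y).2
    (coverBody_of_coverKerBody _ 𝒜 ρ D pol lvl 𝔞 n _ _ ((coverKerE_iff_coverKerBody S Kc w e 𝒜 ρ D pol lvl e' 𝔞 n y).1 h))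

end Junction

/-! ### §1 THE CORE: the bodies move along any `x : Spec Ω → Spec Ω′` of point fields, target points by value (★ p850295) -/

section Core

variable {F : Type} [Field F] [NumberField F] [IsCMField F] {Y : AlgebraicGeometry.Scheme.{0}} (Ω Ω' : Type) [Field Ω] [Field Ω']
  (univ : AbelianSchemeOver Y) (act : RingAction (𝓞 F) univ) (dual : univ.DualPair)
  (hD : Nonempty ((AlgebraicGeometry.Scheme.Modules.pullback dual.unitHatSlice).obj dual.P ≅ SheafOfModules.unit _))
  (pol : univ.Polarization dual) {g N : ℕ} (lvl : univ.LevelStructure g N) (𝔞 : Ideal (𝓞 F)) (n : ℕ)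
  (ℓ ℓ' : AlgebraicGeometry.Spec (.of Ω') ⟶ Y) (x : AlgebraicGeometry.Spec (.of Ω) ⟶ AlgebraicGeometry.Spec (.of Ω'))
  (m m' : AlgebraicGeometry.Spec (.of Ω) ⟶ Y) (hm : x ≫ ℓ = m) (hm' : x ≫ ℓ' = m')

include hD hm hm' in
/-- `coverKerBody` read at `(ℓ, ℓ′)` over `Ω′` gives the reading at `(m, m′)` over `Ω` for ANY `x : Spec Ω → Spec Ω′` with `x ≫ ℓ = m`, `x ≫ ℓ′ = m′` — ★
`coverKer_readAt_comp_of_eq` with the torsion predicates `(· ∈ 𝔞)`, `(· ∈ c•𝔞)`, `ν := (n : 𝓞 F)` (the two bodies agree definitionally); `hD` = the Poincaré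
normalisation of `dual`. [cite: MumfordFogartyKirwan1994, Ch. 7 §2 Definition 7.2 (p. 129)] [cite: GortzWedhorn2020, Section (4.7) (pp. 107–108)] -/
theorem coverKerBody_of_eq (h : coverKerBody Ω' univ act dual pol lvl 𝔞 n ℓ ℓ') : coverKerBody Ω univ act dual pol lvl 𝔞 n m m' :=
  Literature.AlgebraicGeometry.AbelianSchemes.AbelianSchemeOver.coverKer_readAt_comp_of_eq univ act dual hD pol lvl ℓ ℓ' x m m' hm hm'
    (fun a => a ∈ 𝔞) (fun b => b ∈ (IsCMField.complexConj F) • 𝔞) ((n : ℕ) : 𝓞 F) n h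

include hD hm hm' in
/-- `coverBody` read at `(ℓ, ℓ′)` over `Ω′` gives the reading at `(m, m′)` over `Ω` for ANY `x` with `x ≫ ℓ = m`, `x ≫ ℓ′ = m′` — ★ `cover_readAt_comp_of_eq`.
[cite: MumfordFogartyKirwan1994, Ch. 7 §2 Definition 7.2 (p. 129)] [cite: GortzWedhorn2020, Section (4.7) (pp. 107–108)] -/
theorem coverBody_of_eq (h : coverBody Ω' univ act dual pol lvl 𝔞 n ℓ ℓ') : coverBody Ω univ act dual pol lvl 𝔞 n m m' :=
  Literature.AlgebraicGeometry.AbelianSchemes.AbelianSchemeOver.cover_readAt_comp_of_eq univ act dual hD pol lvl ℓ ℓ' x m m' hm hm'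
    (fun a => a ∈ 𝔞) (fun b => b ∈ (IsCMField.complexConj F) • 𝔞) ((n : ℕ) : 𝓞 F) n h

end Core

end Summit.HodgeConjecture.HodgeConjecture.Cruxes.HLiu418.F0P6aCoverEOfComplex
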